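import Summits.ResolutionOfSingularities.ResolutionOfSingularities.Theorems.ExitLawClasses
import Summits.ResolutionOfSingularities.ResolutionOfSingularities.Theorems.MaxContactCutItineraryCut
import Summits.ResolutionOfSingularities.ResolutionOfSingularities.Theorems.ProximityCutOrigin
import HarnessLib

/-!
# MaxContactCutExitLaw — the decomp-res node «ExitLaw» BY NAME on the host route `MaxContactCut` (lens-5 g15,
sha256 fd5076a831344d35; critic row 119 CLEARED)

Tree file 4/4: the kernels reaching aside 31770 `MaxContactCut.DefectWalksDeep` BY NAME — `closes_excess`,
`closes`, `closes'`,
`closes_arc_sat`, the EXACT cuts `defectWalksDeep_iff_excess` / `defectWalksDeep_iff_residual`, rev 1 `closes₁` /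
`defectWalksDeep_iff_residual₁` (g14's recurrent-jump half DISCHARGED from the tree `NoJump`), and the JOIN with lens-3's
translation axis: `noRepeatExcess_of_origin_joint`, `closes₂`, `defectWalksDeep_iff_joint` — VERBATIM, except that
`NoOriginTails` is the tree's `ProximityCut.NoOriginTails` (lens-3 g12, `ProximityCutOrigin`, PROVED there:
`ProximityCut.noOriginTails_holds`), so the `hO` hypothesis is also offered discharged (`closes₂'`,
`defectWalksDeep_iff_joint'`).
(Sources: Hauser2010 §§F–G; CossartPiltant2019; CossartJannsenSaito2020.)
-/

open MvPolynomial Finset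
open scoped BigOperators
open Literature.AlgebraicGeometry.Resolution
open Literature.AlgebraicGeometry.Resolution.Hauser2010
open Literature.AlgebraicGeometry.Resolution.PointBlowup
open Literature.AlgebraicGeometry.Resolution.WeightedBlowup
open Literature.Barriers.ResolutionOfSingularities
open Summit.ResolutionOfSingularities.ResolutionOfSingularities.Theses
open Summit.ResolutionOfSingularities.ResolutionOfSingularities.Theorems.TightDefectClasses
open Summit.ResolutionOfSingularities.ResolutionOfSingularities.Theorems.TightDefectStrongWalks
open Summit.ResolutionOfSingularities.ResolutionOfSingularities.Theorems.ItineraryCutClasses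
open Summit.ResolutionOfSingularities.ResolutionOfSingularities.Theorems.BoundaryLedger
open Summit.ResolutionOfSingularities.ResolutionOfSingularities.Theorems.ProximityCut

namespace Summit.ResolutionOfSingularities.ResolutionOfSingularities.Theorems.ExitLaw

/-- KERNEL (excess form): the recurrent-jump half (g14, PROVED in `NoJump.lean`), the deep arc law (DECIDED, port)
and the positive-excess plateaux give `MaxContactCut.DefectWalksDeep`. [folklore] -/
theorem closes_excess (hJ : NoRecurrentJumpWalksDeep) (hA : NoFreePointTailsDeep) (hX : NoExcessPlateauxDeep) :
    MaxContactCut.DefectWalksDeep :=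
  MaxContactCutTightDefect.defectWalksDeep_iff.mpr
    (defectDeep_iff.mpr ⟨noPlateau_iff_frozen_excess.mpr ⟨noFrozen_of_freeTails hA, hX⟩, hJ⟩)

/-- **KERNEL `closes` (host 31770 `MaxContactCut.DefectWalksDeep` BY NAME)**: recurrent-jump half (g14, PROVED) ∧
deep arc law (DECIDED-MOD-PORT) ∧ THE RESIDUAL (repeat-recurrent excess plateaux) ⇒ 31770. [folklore] -/
theorem closes (hJ : NoRecurrentJumpWalksDeep) (hA : NoFreePointTailsDeep)
    (hR : NoRepeatRecurrentExcessPlateauxDeep) : MaxContactCut.DefectWalksDeep :=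
  closes_excess hJ hA (noExcess_of_freeTails_repeat hA hR)

/-- … the same kernel from the all-`e` arc law. [folklore] -/
theorem closes' (hJ : NoRecurrentJumpWalksDeep) (hA : NoFreePointTails) (hR : NoRepeatRecurrentExcessPlateauxDeep) :
    MaxContactCut.DefectWalksDeep :=
  closes hJ (freeTailsDeep_of_all hA) hR

/-- … and the two-column kernel (no g14 needed). [folklore] -/
theorem closes_arc_sat (hA : NoFreePointTailsDeep) (hS : SatDefectWalksTerminateDeep) :
    MaxContactCut.DefectWalksDeep :=
  MaxContactCutTightDefect.defectWalksDeep_iff.mpr (defectDeep_iff_arc_sat.mpr ⟨hA, hS⟩)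

/-- THE EXACT THREE-PIECE CUT OF 31770 along the excess axis (PROVED). [folklore] -/
theorem defectWalksDeep_iff_excess :
    MaxContactCut.DefectWalksDeep ↔ NoRecurrentJumpWalksDeep ∧ NoFreePointTailsDeep ∧ NoExcessPlateauxDeep := by
  refine ⟨fun h => ?_, fun ⟨hJ, hA, hX⟩ => closes_excess hJ hA hX⟩
  have h' := MaxContactCutTightDefect.defectWalksDeep_iff.mp h
  exact ⟨(defectDeep_iff.mp h').2, freeTailsDeep_of_defect h', noExcess_of_noPlateau (defectDeep_iff.mp h').1⟩

/-- THE EXACT CUT OF 31770 DOWN TO THE RESIDUAL (PROVED): `31770 ⟺ g14 ∧ arc law ∧ residual`. [folklore] -/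
theorem defectWalksDeep_iff_residual :
    MaxContactCut.DefectWalksDeep ↔
      NoRecurrentJumpWalksDeep ∧ NoFreePointTailsDeep ∧ NoRepeatRecurrentExcessPlateauxDeep := by
  refine ⟨fun h => ?_, fun ⟨hJ, hA, hR⟩ => closes hJ hA hR⟩
  obtain ⟨hJ, hA, hX⟩ := defectWalksDeep_iff_excess.mp h
  exact ⟨hJ, hA, noRepeatExcess_of_noExcess hX⟩


/-- KERNEL without the g14 hypothesis: deep arc law ∧ residual ⇒ 31770. [folklore] -/
theorem closes₁ (hA : NoFreePointTailsDeep) (hR : NoRepeatRecurrentExcessPlateauxDeep) :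
    MaxContactCut.DefectWalksDeep :=
  closes NoJump.noRecurrentJumpWalksDeep_holds hA hR

/-- THE EXACT TWO-PIECE CUT (PROVED, g14 discharged): `31770 ⟺ arc law ∧ residual`. [folklore] -/
theorem defectWalksDeep_iff_residual₁ :
    MaxContactCut.DefectWalksDeep ↔ NoFreePointTailsDeep ∧ NoRepeatRecurrentExcessPlateauxDeep := by
  rw [defectWalksDeep_iff_residual]
  exact ⟨fun h => h.2, fun h => ⟨NoJump.noRecurrentJumpWalksDeep_holds, h⟩⟩

/-- **THE TRANSLATION CUT OF THE RESIDUAL (PROVED)**: a repeat-recurrent excess plateau is translation-recurrent (the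
joint residual) or has an origin tail (lens-3 g12's `NoOriginTails`). [folklore] -/
theorem noRepeatExcess_of_origin_joint (hO : NoOriginTails) (hR : NoRepeatTranslationRecurrentExcessPlateauxDeep) :
    NoRepeatRecurrentExcessPlateauxDeep := by
  intro p hp e he K _ _ _ _ s₀ hs W hW N hN hex hrec
  by_cases htr : ∀ M : ℕ, ∃ t, M ≤ t ∧ W.b t ≠ 0
  · exact hR p hp e he K s₀ hs W hW N hN hex hrec htr
  · push Not at htr
    obtain ⟨M, hM⟩ := htr
    exact hO p hp e (by omega) K s₀ hs W M hM

/-- **KERNEL `closes₂` (rev 1; host 31770 BY NAME)**: deep arc law (DECIDED-MOD-PORT) ∧ `NoOriginTails` (DECIDED,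
lens-3 g12) ∧ THE JOINT RESIDUAL ⇒ `MaxContactCut.DefectWalksDeep` (g14's half discharged from the tree). [folklore] -/
theorem closes₂ (hA : NoFreePointTailsDeep) (hO : NoOriginTails)
    (hR : NoRepeatTranslationRecurrentExcessPlateauxDeep) : MaxContactCut.DefectWalksDeep :=
  closes₁ hA (noRepeatExcess_of_origin_joint hO hR)

/-- THE EXACT CUT DOWN TO THE JOINT RESIDUAL (PROVED), conditional only on the DECIDED `NoOriginTails`:
`31770 ⟺ arc law ∧ joint residual`. [folklore] -/
theorem defectWalksDeep_iff_joint (hO : NoOriginTails) :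
    MaxContactCut.DefectWalksDeep ↔ NoFreePointTailsDeep ∧ NoRepeatTranslationRecurrentExcessPlateauxDeep := by
  rw [defectWalksDeep_iff_residual₁]
  exact ⟨fun ⟨hA, hR⟩ => ⟨hA, noJoint_of_noRepeatExcess hR⟩,
    fun ⟨hA, hR⟩ => ⟨hA, noRepeatExcess_of_origin_joint hO hR⟩⟩

/-- `closes₂` with lens-3's `NoOriginTails` DISCHARGED from the tree (`ProximityCut.noOriginTails_holds`): deep arc law ∧
joint residual ⇒ 31770. [folklore] -/
theorem closes₂' (hA : NoFreePointTailsDeep) (hR : NoRepeatTranslationRecurrentExcessPlateauxDeep) :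
    MaxContactCut.DefectWalksDeep :=
  closes₂ hA noOriginTails_holds hR

/-- THE EXACT CUT DOWN TO THE JOINT RESIDUAL, hypothesis-free: `31770 ⟺ deep arc law ∧ joint residual`. [folklore] -/
theorem defectWalksDeep_iff_joint' :
    MaxContactCut.DefectWalksDeep ↔ NoFreePointTailsDeep ∧ NoRepeatTranslationRecurrentExcessPlateauxDeep :=
  defectWalksDeep_iff_joint noOriginTails_holds

end Summit.ResolutionOfSingularities.ResolutionOfSingularities.Theorems.ExitLaw
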